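import Summits.ABC.ABC.Theses.CuspFieldPencil
import Summits.ABC.ABC.Theorems.YuMatveevShapeRatCloses
import Literature.NumberTheory.DiophantineGeometry.PastenSubexpPlaces
import Literature.Barriers.ABC.BakerMethodBoundsHalfExponentProofs
import HarnessLib

/-!
# Stub-ideation sketch (ideator k1, gen 2, FAMILY 1 — recognise & import) for `stub_splitCuspTriple`
# of crux `GoldenCuspShadow` (route `CuspFieldPencil`, item stmt-ABC-26026): the UNCONDITIONAL
# rational place-bound line.

SIGNATURES ONLY (bodies `sorry` except the ring identities and the final by-name compositions); the
file elaborates against the tree (rc 0, sorries = helper bodies).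

IMPORTED INPUT (a THEOREM of the tree, axioms {propext, Classical.choice, Quot.sound}):
`Summit.ABC.ABC.Theorems.approximationBound_rat_holds : Dioph.approximationBound_rat`
(`∃ K ≥ 1, PastenApproximationBound K` — Matveev 2000 + Yu 2007 over ℚ in Pasten's shape form, route
`YuMatveevShapeRat` CLOSED·proved 2026-08-27/28), consumed through Pasten's K-parametric place bounds
`Pasten.arch_bound` / `Pasten.padic_bound_a` / `Pasten.padic_bound_c` on the two hidden ℤ-abc-triples
of the pencil, `T_u : w² + Q = u(u − 11w)` and `T_w : Q + w(w + 11u) = u²`, `Q = u² − 11uw − w²`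
(`T_w = T_u` at `(u, w) ↦ (w, −u)`).  The place bounds are MEMBER-LOCAL: the bound for the member
`u(u − 11w)` lives on the primes of the OTHER two members `w², |Q|` only, and we sum the `p`-adic bound
over the primes of the divisor `u` only — `rad(u − 11w)` never enters.
-/

set_option linter.dupNamespace false

noncomputable section

open Finset Real Height UniqueFactorizationMonoid
open Literature.NumberTheory.DiophantineGeometry
open Literature.NumberTheory.DiophantineGeometry.Dioph
open Literature.NumberTheory.DiophantineGeometry.Pasten
open Literature.Barriers.ABC

namespace Summit.ABC.ABC.Cruxes.GoldenCuspShadow.SplitCuspRat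

/-! ### 0. Statements -/

/-- The registered stub `stub_splitCuspTriple`, verbatim. -/
def StubSplitCuspTriple : Prop :=
  ∀ ε : ℝ, 0 < ε → ∃ κ : ℝ, ∀ u w : ℤ, IsCoprime u w → u * w * (u ^ 2 - 11 * u * w - w ^ 2) ≠ 0 →
    Real.log (max (|(u : ℝ)|) (|(w : ℝ)|)) ≤
      κ * (((UniqueFactorizationMonoid.radical (u * w * (u ^ 2 - 11 * u * w - w ^ 2))).natAbs : ℕ) : ℝ) ^ (ε : ℝ) *
        (((((UniqueFactorizationMonoid.radical u).natAbs : ℕ) : ℝ) *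
            (((UniqueFactorizationMonoid.radical w).natAbs : ℕ) : ℝ)) ^ (2 / 3 : ℝ) *
          (((UniqueFactorizationMonoid.radical (u ^ 2 - 11 * u * w - w ^ 2)).natAbs : ℕ) : ℝ) ^ (1 / 3 : ℝ))

/-- **Route-U bound** (one member-local Stewart–Yu route): `log max(|u|,|w|) ≤ κ_ε · rad(uwQ)^ε · rad u`. -/
def RouteBoundU : Prop :=
  ∀ ε : ℝ, 0 < ε → ∃ κ : ℝ, ∀ u w : ℤ, IsCoprime u w → u * w * (u ^ 2 - 11 * u * w - w ^ 2) ≠ 0 →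
    Real.log (max (|(u : ℝ)|) (|(w : ℝ)|)) ≤
      κ * (((radical (u * w * (u ^ 2 - 11 * u * w - w ^ 2))).natAbs : ℕ) : ℝ) ^ ε *
        (((radical u).natAbs : ℕ) : ℝ)

/-- **Route-W bound**: the same with `rad w` (= `RouteBoundU` at `(w, −u)`). -/
def RouteBoundW : Prop :=
  ∀ ε : ℝ, 0 < ε → ∃ κ : ℝ, ∀ u w : ℤ, IsCoprime u w → u * w * (u ^ 2 - 11 * u * w - w ^ 2) ≠ 0 →
    Real.log (max (|(u : ℝ)|) (|(w : ℝ)|)) ≤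
      κ * (((radical (u * w * (u ^ 2 - 11 * u * w - w ^ 2))).natAbs : ℕ) : ℝ) ^ ε *
        (((radical w).natAbs : ℕ) : ℝ)

/-- **The min-radical bound** (U ∧ W): `log max(|u|,|w|) ≤ κ_ε · rad(uwQ)^ε · min(rad u, rad w)`.
It implies the stub (`min ≤ (rad u rad w)^{1/2} ≤ (rad u rad w)^{2/3} rad(Q)^{1/3}`) and the crux
(`min(rad u, rad w) ≤ rad(uwQ)^{1/2}`). -/
def MinRadBound : Prop :=
  ∀ ε : ℝ, 0 < ε → ∃ κ : ℝ, ∀ u w : ℤ, IsCoprime u w → u * w * (u ^ 2 - 11 * u * w - w ^ 2) ≠ 0 →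
    Real.log (max (|(u : ℝ)|) (|(w : ℝ)|)) ≤
      κ * (((radical (u * w * (u ^ 2 - 11 * u * w - w ^ 2))).natAbs : ℕ) : ℝ) ^ ε *
        min ((((radical u).natAbs : ℕ) : ℝ)) ((((radical w).natAbs : ℕ) : ℝ))

/-- `Θ_K(n) = K^{ω(n)+1} ∏_{p ∣ n} log p` — the value of Pasten's `theta K x y 0` on a coprime pair with
`x·y = n` (`Literature.Barriers.ABC.theta_zero_eq`). -/
def Theta (K : ℝ) (n : ℕ) : ℝ := K ^ (n.primeFactors.card + 1) * ∏ p ∈ n.primeFactors, Real.log p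

/-- `Y(c) = log max{e, 2 log c}` — the log-log factor of Pasten's place bounds. -/
def Yfac (c : ℝ) : ℝ := Real.log (max (Real.exp 1) (2 * Real.log c))

/-- `σ(d) = Σ_{p ∣ d} p`. -/
def sig (d : ℕ) : ℝ := ∑ p ∈ d.primeFactors, (p : ℝ)

/-! ### H0. The hidden triples and the symmetry (XS, `ring`) -/

theorem pencil_identity_u (u w : ℤ) : w ^ 2 + (u ^ 2 - 11 * u * w - w ^ 2) = u * (u - 11 * w) := by ring

theorem pencil_identity_w (u w : ℤ) : (u ^ 2 - 11 * u * w - w ^ 2) + w * (w + 11 * u) = u ^ 2 := by ring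

/-- `Q(w, −u) = −Q(u, w)`: route W is route U at `(w, −u)` (and `u·w·Q ↦ u·w·Q`). -/
theorem quadForm_swap (u w : ℤ) : w ^ 2 - 11 * w * (-u) - (-u) ^ 2 = -(u ^ 2 - 11 * u * w - w ^ 2) := by
  ring

/-! ### H1. Integer bookkeeping (S) -/

/-- `gcd(w², Q) = 1` (cf. `Summit.ABC.ABC.Theorems.GoldenFromNFPencil.isCoprime_quadForm_right`). -/
theorem isCoprime_sq_quadForm {u w : ℤ} (h : IsCoprime u w) :
    IsCoprime (w ^ 2) (u ^ 2 - 11 * u * w - w ^ 2) := by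
  sorry

/-- `|Q| ≤ 13 H²`; hence every member of `T_u`, `T_w` is `≤ 14 H²`, `H = max(|u|,|w|)`. -/
theorem abs_quadForm_le (u w : ℤ) :
    |((u ^ 2 - 11 * u * w - w ^ 2 : ℤ) : ℝ)| ≤ 13 * (max (|(u : ℝ)|) (|(w : ℝ)|)) ^ 2 := by
  sorry

/-- The degenerate points of route U (`u = 11w`) resp. W (`w = −11u`) have height `11`
(coprimality forces `(u,w) = ±(11,1)` resp. `±(1,−11)`); they are absorbed into `κ ≥ log 11`. -/
theorem height_eq_eleven_of_degenerate {u w : ℤ} (h : IsCoprime u w)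
    (h0 : u * w * (u ^ 2 - 11 * u * w - w ^ 2) ≠ 0) (hdeg : u = 11 * w ∨ w = -11 * u) :
    max (|(u : ℝ)|) (|(w : ℝ)|) = 11 := by
  sorry

/-! ### H2. The member-local route lemma (M) — all positional plumbing lives here.
For an integer identity `x + y = m` (`x, y, m ≠ 0`, `gcd(x,y) = 1`, `|x|·|y| > 1`) the ℕ-abc-triple on
`{|x|, |y|, |m|}` gives, with `Θ = Θ_K(|x|·|y|)` (the theta of the two members OTHER than `m`, by
`theta_zero_eq`) and `Y = Y(top member)`:
(i) divisor form of the `p`-adic route — for `d ∣ m`: `log d ≤ Θ · Y · 3σ(d)` (`Pasten.padic_bound_a/_c`,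
`h.swap` for the middle slot, `ν_p(d) ≤ ν_p(m)`, `Literature.Barriers.ABC.div_log_mul_add_le`);
(ii) the archimedean route — `log(top) − log|m| < Θ · Y` (`Pasten.arch_bound`; `0 < Θ·Y` when `m` is the top).
Pattern to copy: `Literature.Barriers.ABC.log_lt_route_a_of_placeBounds`. -/

theorem member_route {K : ℝ} (hK : 1 ≤ K) (hP : PastenApproximationBound K) {x y m : ℤ}
    (hsum : x + y = m) (hx : x ≠ 0) (hy : y ≠ 0) (hm : m ≠ 0) (hcop : IsCoprime x y)
    (h1 : 1 < x.natAbs * y.natAbs) :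
    (∀ d : ℕ, d ∣ m.natAbs →
        Real.log d ≤ Theta K (x.natAbs * y.natAbs) *
          Yfac (max (max (|(x : ℝ)|) (|(y : ℝ)|)) (|(m : ℝ)|)) * (3 * sig d)) ∧
      Real.log (max (max (|(x : ℝ)|) (|(y : ℝ)|)) (|(m : ℝ)|)) - Real.log (|(m : ℝ)|) <
        Theta K (x.natAbs * y.natAbs) * Yfac (max (max (|(x : ℝ)|) (|(y : ℝ)|)) (|(m : ℝ)|)) := by
  sorry

/-! ### H3. The two routes of the pencil (S given H2; W is U at `(w, −u)`) -/

/-- Route U: `T_u` with `x = w²`, `y = Q`, `m = u(u − 11w)`, divisor `d = |u|`; if `|u| = H` then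
`L = log|u|`, else `|w| = H`, the top member is `≥ w² = H²` and
`L − log|u| ≤ (log top − log|m|) + log 12`. -/
theorem route_u {K : ℝ} (hK : 1 ≤ K) (hP : PastenApproximationBound K) {u w : ℤ}
    (huw : IsCoprime u w) (h0 : u * w * (u ^ 2 - 11 * u * w - w ^ 2) ≠ 0) (h11 : u ≠ 11 * w) :
    Real.log (max (|(u : ℝ)|) (|(w : ℝ)|)) < Real.log 12 +
      Theta K (w.natAbs ^ 2 * (u ^ 2 - 11 * u * w - w ^ 2).natAbs) *
        Yfac (14 * (max (|(u : ℝ)|) (|(w : ℝ)|)) ^ 2) * (1 + 3 * sig u.natAbs) := by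
  sorry

theorem route_w {K : ℝ} (hK : 1 ≤ K) (hP : PastenApproximationBound K) {u w : ℤ}
    (huw : IsCoprime u w) (h0 : u * w * (u ^ 2 - 11 * u * w - w ^ 2) ≠ 0) (h11 : w ≠ -11 * u) :
    Real.log (max (|(u : ℝ)|) (|(w : ℝ)|)) < Real.log 12 +
      Theta K (u.natAbs ^ 2 * (u ^ 2 - 11 * u * w - w ^ 2).natAbs) *
        Yfac (14 * (max (|(u : ℝ)|) (|(w : ℝ)|)) ^ 2) * (1 + 3 * sig w.natAbs) := by
  sorry

/-! ### H4. Accounting (S) -/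

/-- `Θ_K(w²·|Q|) ≤ K · C_δ · rad(w·Q)^δ`: `∏_{p ∣ n} (K log p) ≤ C_{K,δ} (∏_{p ∣ n} p)^δ`
(clone of `Literature.Barriers.ABC.exists_prod_mul_log_div_le` with exponent `δ`). -/
theorem exists_prod_mul_log_le_rpow {A δ : ℝ} (hA : 0 ≤ A) (hδ : 0 < δ) :
    ∃ C : ℝ, 1 ≤ C ∧ ∀ S : Finset ℕ, (∀ p ∈ S, p.Prime) →
      ∏ p ∈ S, A * Real.log p ≤ C * (∏ p ∈ S, (p : ℝ)) ^ δ := by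
  sorry

/-- `σ(d) ≤ rad d`: a sum of distinct primes is at most their product. -/
theorem sig_le_prod (d : ℕ) : sig d ≤ ∏ p ∈ d.primeFactors, (p : ℝ) := by
  sorry

/-! ### H5. Endgame (S): remove the log-log factor -/

theorem le_of_le_mul_loglog {δ : ℝ} (hδ : 0 < δ) :
    ∃ C : ℝ, 0 < C ∧ ∀ y A X : ℝ, 0 ≤ y → 0 ≤ A → 1 ≤ X →
      y ≤ A + X * Real.log (max (Real.exp 1) (2 * Real.log (14 * Real.exp y ^ 2))) →
        y ≤ C * (A + 1) * X ^ (1 + δ) := by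
  sorry

/-! ### H6. Cast glue (XS): Mathlib `Int.radical_eq_prod_primeFactors`, `Nat.primeFactors_pow`,
`Nat.Coprime.primeFactors_mul` -/

theorem natAbs_radical_cast (z : ℤ) :
    (((radical z).natAbs : ℕ) : ℝ) = ∏ p ∈ z.natAbs.primeFactors, (p : ℝ) := by
  sorry

theorem primeFactors_sq_mul {a b : ℕ} (hab : a.Coprime b) (ha : a ≠ 0) (hb : b ≠ 0) :
    (a ^ 2 * b).primeFactors = a.primeFactors ∪ b.primeFactors ∧
      Disjoint a.primeFactors b.primeFactors := by
  sorry

/-! ### Assembly -/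

/-- H1–H6 ⇒ route-U bound for every `K ≥ 1` with `PastenApproximationBound K`. (M) -/
theorem routeBoundU_of_pasten {K : ℝ} (hK : 1 ≤ K) (hP : PastenApproximationBound K) :
    RouteBoundU := by
  sorry

/-- Route W from route U at `(w, −u)` (`quadForm_swap`, `radical_neg`, `IsCoprime.neg_right`). (S) -/
theorem routeBoundW_of_routeBoundU (h : RouteBoundU) : RouteBoundW := by
  sorry

theorem minRadBound_of_routes (hU : RouteBoundU) (hW : RouteBoundW) : MinRadBound := by
  sorry

/-- UNCONDITIONAL, by the tree theorem `approximationBound_rat_holds`. -/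
theorem minRadBound : MinRadBound := by
  obtain ⟨K, hK, hP⟩ := Summit.ABC.ABC.Theorems.approximationBound_rat_holds
  have hU := routeBoundU_of_pasten hK hP
  exact minRadBound_of_routes hU (routeBoundW_of_routeBoundU hU)

/-- The stub: `min(a,b) ≤ (ab)^{1/2} ≤ (ab)^{2/3}` and `rad(Q)^{1/3} ≥ 1` (bases `≥ 1`). (S) -/
theorem stubSplitCuspTriple_of_minRadBound (h : MinRadBound) : StubSplitCuspTriple := by
  sorry

/-- The crux: `min(rad u, rad w) ≤ (rad u · rad w)^{1/2} ≤ rad(uwQ)^{1/2}`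
(`GoldenFromNFPencil.natAbs_radical_prod`, `Real.rpow_add`). (S) -/
theorem goldenCuspShadow_of_minRadBound (h : MinRadBound) :
    Summit.ABC.ABC.Theses.CuspFieldPencil.GoldenCuspShadow := by
  sorry

theorem stubSplitCuspTriple : StubSplitCuspTriple :=
  stubSplitCuspTriple_of_minRadBound minRadBound

/-- What the landing file's last line will be (closes stmt-ABC-26026 outright). -/
theorem goldenCuspShadow : Summit.ABC.ABC.Theses.CuspFieldPencil.GoldenCuspShadow :=
  goldenCuspShadow_of_minRadBound minRadBound

end Summit.ABC.ABC.Cruxes.GoldenCuspShadow.SplitCuspRat
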